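import Summits.Ventures.PercRepro.Night2NonFatColoopPhi

/-!
# night-2: the NON-FAT case of (FAIR) — the coloop count over the pairs independent modulo the plane (gen 37)

The remainder `R = T ∖ B′` of a thin four-point member `B′` inside the coloop target `T = Q ∪ {y}` not only avoids
`P = cl (W ∖ y)`: `(W ∖ y) ∪ R` spans `V` (`rk (G ∖ B′) ≥ 5`), i.e. the two points of `R` are INDEPENDENT MODULO `P`
(`five_le_rkN_erase_union_sdiff`).  So the member faces inject into the pairs `R ⊆ (T ∖ K) ∖ P` with `rk ((W ∖ y) ∪ R) ≥ 5`
(`card_thin_faces_le_indep_pairs`), and with the weight `phiM m₀` of `Night2NonFatColoopPhi`: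
**`faceSum_insert_le_indep_pairs`**: `faceSum T ≤ 2 · phiM m₀ · #{R : |R| = 2, R ⊆ (T ∖ K) ∖ P, rk ((W ∖ y) ∪ R) ≥ 5}`, and the
coloop point's term is at least the reciprocal (`level_one_term_ge_of_coloop_indep`).  This is the sharp form of the coloop bound:
pairs inside a hyperplane through `P` (two points of `T′` on one plane through the line of `W`, say) do not count.
Paper: proofs/NIGHT-2-g37.md §2.
-/

namespace PercRepro.Shadow

open PercRepro.ThmH PercRepro.PerFlat

variable {α : Type*} [DecidableEq α] {M : Matroid α} [M.Finite] {G : Finset α}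

open scoped Classical in
/-- The pairs of points of `(T ∖ K) ∖ cl (W ∖ y)` (`T = Q ∪ {y}`) independent modulo `W ∖ y`: `(W ∖ y) ∪ R` spans `V`. -/
noncomputable def indepPairs (M : Matroid α) [M.Finite] (G B : Finset α) (z y : α) : Finset (Finset α) :=
  (((insert y (insert z B) \ coloops M G) \ clF M ((G \ insert z B).erase y)).powersetCard 2).filter
    (fun R => 5 ≤ rkN M ((G \ insert z B).erase y ∪ R))

/-- **`(W ∖ y) ∪ (T ∖ B′)` spans `V`** for a thin member `B′ ⊆ T = Q ∪ {y}`: it contains `G ∖ B′`, of rank `≥ 5`. -/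
theorem five_le_rkN_erase_union_sdiff (hG : G ∈ flatsQ M (5 + 1)) (hd : (gr M \ G).card = 2)
    {B : Finset α} (hB : B ∈ thinMembers M 5 G) {z : α} (hz : z ∈ G \ clF M B) {y : α}
    {B' : Finset α} (hB' : B' ∈ thinMembers M 5 G) :
    5 ≤ rkN M ((G \ insert z B).erase y ∪ (insert y (insert z B) \ B')) := by
  have h5 : 5 ≤ rkN M (G \ B') := five_le_rkN_sdiff_of_mem_Uq hd (mem_membersIn.1 (mem_thinMembers.1 hB').1).1
  have hsub : G \ B' ⊆ (G \ insert z B).erase y ∪ (insert y (insert z B) \ B') := by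
    intro e he
    rw [Finset.mem_sdiff] at he
    rw [Finset.mem_union, Finset.mem_erase, Finset.mem_sdiff, Finset.mem_sdiff]
    by_cases heT : e ∈ insert y (insert z B)
    · exact Or.inr ⟨heT, he.2⟩
    · left
      refine ⟨fun h => heT (h ▸ Finset.mem_insert_self _ _), he.1, fun h => heT (Finset.mem_insert_of_mem h)⟩
  have _ := hG
  have _ := hB
  have _ := hz
  exact le_trans h5 (rkN_mono hsub)

open scoped Classical in
/-- **The member faces inside a coloop target inject into the pairs independent modulo the plane.** -/
theorem card_thin_faces_le_indep_pairs (hG : G ∈ flatsQ M (5 + 1)) (hd : (gr M \ G).card = 2)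
    (hk : kColoops M G = 1) {B : Finset α} (hB : B ∈ thinMembers M 5 G) (hnP : ¬ bigP M G B) {z : α}
    (hz : z ∈ G \ clF M B) {y : α} (hy : y ∈ G \ insert z B)
    (hr : rkN M ((G \ insert z B).erase y) ≤ 3) :
    ((thinMembers M 5 G).filter (fun B' => ¬ bigP M G B' ∧ B' ⊆ insert y (insert z B))).card ≤
      (indepPairs M G B z y).card := by
  have hd' : (gr M \ G).card ≤ 5 := by omega
  unfold indepPairs
  apply Finset.card_le_card_of_injOn (fun B' => insert y (insert z B) \ B')
  · intro B' hB'
    rw [Finset.mem_coe, Finset.mem_filter] at hB'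
    obtain ⟨hB'thin, hnP', hB'T⟩ := hB'
    rw [Finset.mem_coe, Finset.mem_filter, Finset.mem_powersetCard]
    have hKB' : coloops M G ⊆ B' := coloops_subset_of_mem_thinMembers hG hd' hB'thin
    have hdisj := sdiff_disjoint_clF_of_thin_subset hG hd hk hB hnP hz hy hr hB'thin hnP' hB'T
    refine ⟨⟨?_, ?_⟩, five_le_rkN_erase_union_sdiff hG hd hB hz hB'thin⟩
    · intro e he
      rw [Finset.mem_sdiff, Finset.mem_sdiff]
      rw [Finset.mem_sdiff] at he
      refine ⟨⟨he.1, fun hK => he.2 (hKB' hK)⟩, ?_⟩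
      exact Finset.disjoint_left.1 hdisj (Finset.mem_sdiff.2 he)
    · have h6 := card_insert_sdiff_coloops_eq_six hG hd hk hB hnP hz hy
      have h4 := card_sdiff_eq_four_of_not_bigP hG hd hk hB'thin hnP'
      have hsub : B' \ coloops M G ⊆ insert y (insert z B) \ coloops M G :=
        Finset.sdiff_subset_sdiff hB'T (le_refl _)
      have heq : insert y (insert z B) \ B' = (insert y (insert z B) \ coloops M G) \ (B' \ coloops M G) := by
        ext e
        simp only [Finset.mem_sdiff, not_and, not_not]
        constructor
        · rintro ⟨heT, heB'⟩
          exact ⟨⟨heT, fun hK => heB' (hKB' hK)⟩, fun h => absurd h heB'⟩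
        · rintro ⟨⟨heT, heK⟩, h⟩
          exact ⟨heT, fun heB' => heK (h heB')⟩
      show (insert y (insert z B) \ B').card = 2
      rw [heq, Finset.card_sdiff_of_subset hsub, h6, h4]
  · intro B₁ hB₁ B₂ hB₂ heq
    rw [Finset.mem_coe, Finset.mem_filter] at hB₁ hB₂
    simp only at heq
    have h1 : B₁ = insert y (insert z B) \ (insert y (insert z B) \ B₁) := (Finset.sdiff_sdiff_eq_self hB₁.2.2).symm
    have h2 : B₂ = insert y (insert z B) \ (insert y (insert z B) \ B₂) := (Finset.sdiff_sdiff_eq_self hB₂.2.2).symm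
    rw [h1, h2, heq]

open scoped Classical in
/-- **The face sum of a coloop target over the pairs independent modulo the plane, with the true weight.** -/
theorem faceSum_insert_le_indep_pairs (hG : G ∈ flatsQ M (5 + 1)) (hd : (gr M \ G).card = 2)
    (hk : kColoops M G = 1) {B : Finset α} (hB : B ∈ thinMembers M 5 G)
    (hnP : ¬ bigP M G B) {z : α} (hz : z ∈ G \ clF M B) {y : α} (hy : y ∈ G \ insert z B)
    (hr : rkN M ((G \ insert z B).erase y) ≤ 3) {m₀ : ℕ}
    (hm : ∀ B' ∈ thinMembers M 5 G, ¬ bigP M G B' → B' ⊆ insert y (insert z B) → m₀ ≤ (G \ clF M B').card) :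
    faceSum M G (insert y (insert z B)) ≤
      2 * phiM m₀ * ((indepPairs M G B z y).card : ℚ) := by
  have hd' : (gr M \ G).card ≤ 5 := by omega
  have hcount := card_thin_faces_le_indep_pairs hG hd hk hB hnP hz hy hr
  unfold faceSum
  calc ∑ B' ∈ (thinMembers M 5 G).filter (fun B' => ¬ bigP M G B' ∧ B' ⊆ insert y (insert z B)),
        phiFace M B' * (((insert y (insert z B) \ coloops M G) \ clF M B').card : ℚ)
      ≤ ∑ B' ∈ (thinMembers M 5 G).filter (fun B' => ¬ bigP M G B' ∧ B' ⊆ insert y (insert z B)), phiM m₀ * 2 := by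
        apply Finset.sum_le_sum
        intro B' hB'
        rw [Finset.mem_filter] at hB'
        obtain ⟨hB'thin, hnP', hB'T⟩ := hB'
        have hphi := phiFace_le_of_le hG hd hB'thin (hm B' hB'thin hnP' hB'T)
        have hc : (((insert y (insert z B) \ coloops M G) \ clF M B').card : ℚ) ≤ 2 := by
          have h6 := card_insert_sdiff_coloops_eq_six hG hd hk hB hnP hz hy
          have h4 := card_sdiff_eq_four_of_not_bigP hG hd hk hB'thin hnP'
          have hsub : B' \ coloops M G ⊆ insert y (insert z B) \ coloops M G :=
            Finset.sdiff_subset_sdiff hB'T (le_refl _)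
          have hsub2 : (insert y (insert z B) \ coloops M G) \ clF M B' ⊆
              (insert y (insert z B) \ coloops M G) \ (B' \ coloops M G) := by
            intro e he
            rw [Finset.mem_sdiff] at he ⊢
            refine ⟨he.1, fun h => he.2 ?_⟩
            exact subset_clF_of_subset_gr ((subset_G_of_mem_thinMembers hB'thin).trans (mem_flatsQ.1 hG).1)
              (Finset.mem_sdiff.1 h).1
          have := Finset.card_le_card hsub2
          rw [Finset.card_sdiff_of_subset hsub, h6, h4] at this
          exact_mod_cast this
        exact mul_le_mul hphi hc (by positivity) (phiM_nonneg _)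
    _ = phiM m₀ * 2 * (((thinMembers M 5 G).filter
          (fun B' => ¬ bigP M G B' ∧ B' ⊆ insert y (insert z B))).card : ℚ) := by
        rw [Finset.sum_const, nsmul_eq_mul, mul_comm]
    _ ≤ phiM m₀ * 2 * ((indepPairs M G B z y).card : ℚ) := by
        apply mul_le_mul_of_nonneg_left _ (mul_nonneg (phiM_nonneg _) (by norm_num))
        exact_mod_cast hcount
    _ = 2 * phiM m₀ * ((indepPairs M G B z y).card : ℚ) := by ring

open scoped Classical in
/-- **The level-1 term of a coloop point, sharp form**: `≥ 1 / (2 · phiM m₀ · #independent pairs)`. -/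
theorem level_one_term_ge_of_coloop_indep (hG : G ∈ flatsQ M (5 + 1)) (hd : (gr M \ G).card = 2)
    (hk : kColoops M G = 1) (hs : ∀ e ∈ gr M, ∀ f ∈ gr M, e ≠ f → rkN M {e, f} = 2)
    (hl : ∀ e ∈ gr M, M.Indep {e}) {B : Finset α}
    (hB : B ∈ thinMembers M 5 G) (hnP : ¬ bigP M G B) {z : α} (hz : z ∈ G \ clF M B)
    (hl0 : loss M 5 G B z ≠ 0) {y : α} (hy : y ∈ G \ insert z B)
    (hr : rkN M ((G \ insert z B).erase y) ≤ 3) {m₀ : ℕ}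
    (hm : ∀ B' ∈ thinMembers M 5 G, ¬ bigP M G B' → B' ⊆ insert y (insert z B) → m₀ ≤ (G \ clF M B').card) :
    1 / (2 * phiM m₀ * ((indepPairs M G B z y).card : ℚ)) ≤
      vCap M G (insert y (insert z B)) / faceSum M G (insert y (insert z B)) := by
  have hT : insert y (insert z B) ∈ tgtSets M 5 G B z :=
    level_one_targets_subset hG hB hz (Finset.mem_image.2 ⟨y, hy, rfl⟩)
  have hpos := faceSum_pos_of_mem_tgtSets hG hd hk hB hnP hz hl0 hT
  have hle := faceSum_insert_le_indep_pairs hG hd hk hB hnP hz hy hr hm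
  rw [vCap_insert_eq_one_of_rkN_erase_le_three hG hd hk hs hl hB hnP hr]
  have hcpos : 0 < 2 * phiM m₀ * ((indepPairs M G B z y).card : ℚ) := lt_of_lt_of_le hpos hle
  rw [div_le_div_iff₀ hcpos hpos]
  linarith

end PercRepro.Shadow
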